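import Literature.NumberTheory.Automorphic.QuaternionUnitsTraceNormalized
import Literature.MeasureTheory.Group.InvariantQuotientTransport
import Mathlib.Topology.Algebra.Group.OpenMapping
import HarnessLib

/-!
# The tori of `D^×` as topological groups, and the volume factors of the trace formula:
`T_𝔸ˣ ≃ₜ* C_{D_𝔸ˣ}(γ)` and `vol(G_γ ⧸ ℝ_{>0} Dˣ_γ) = vol(T_𝔸ˣ ⧸ ℝ_{>0} Tˣ)`, `T = K(γ)`
(Gelbart, *Automorphic forms on adele groups* (1975), Remark 9.23 (p. 140), (10.14) and p. 154)

Topic `NumberTheory/Automorphic`. Definitions (`quaternionTorusHom`, `quaternionTorusEquiv`, `unitsTorusEquiv`) and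
theorems; no named fact, no instance. Continuation of `QuaternionAdelicTorus` (where
`C_{D_𝔸ˣ}(γ) = image of T_𝔸ˣ`, `centralizer_inclAdelic_eq_range`, was proved as an equality of
subgroups) and of `QuaternionUnitsTraceNormalized` (the `D^×` trace formula with the printed volume
factors `vol(G_c ⧸ H_c)`, `G_c = C_{D_𝔸ˣ}(γ_c)`, `H_c = ℝ_{>0} Dˣ ∩ G_c`).

In Gelbart's comparison of (10.14) with (10.15) (pp. 154–155) the elliptic terms of both trace
formulas are rewritten as sums over the quadratic extensions `E/K` embeddable in `D`, with volume
factors `meas(Z'_𝔸 B_F \ B_𝔸)`, `B = B(E)` the centraliser of `E` — a torus `E_𝔸ˣ` which sits once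
in `D_𝔸ˣ` and once in `GL₂(𝔸)`, "Tamagawa measures being taken on both sides". To compare the
two volume factors one must know that each is the covolume of `ℝ_{>0} Eˣ` in the idele group `E_𝔸ˣ`
**as a topological group**, independently of the ambient group. This file proves it on the `D`
side:

* `quaternionTorusHom`, `quaternionTorusHom_bijective`, `continuous_quaternionTorusHom`, `isOpenMap_quaternionTorusHom`, `quaternionTorusEquiv` —
  for a regular `γ ∈ Dˣ` (`γ ∉ K`), `T = C_D(γ) = K(γ)`, **the map `T_𝔸ˣ → C_{D_𝔸ˣ}(γ)` induced by
  `T ↪ D` is an isomorphism of topological groups** (`ContinuousMulEquiv`): bijective by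
  `centralizer_inclAdelic_eq_range` and the injectivity of `𝔸 ⊗ T → 𝔸 ⊗ D`
  (`unitsMapRight_injective`, flatness), continuous, and open by the open mapping theorem for
  the σ-compact group `T_𝔸ˣ` onto the locally compact `C_{D_𝔸ˣ}(γ)`
  (Mathlib `MonoidHom.isOpenMap_of_sigmaCompact`).
* `unitsMapRight_mem_quotientSubgroup_iff` — **`w ∈ ℝ_{>0} Tˣ` iff its image lies in
  `ℝ_{>0} Dˣ`**: if the image is `a · d` (`a ∈ ℝ_{>0}` central, `d ∈ Dˣ`, by the central retraction
  of `QuaternionAlgebraAdelicMeasureProofs`), then `d` commutes with `γ`, so `d ∈ Tˣ` (`T` is a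
  field, `forall_isUnit_centralizer`) and `w = a · d` by injectivity. Hence the isomorphism carries
  `ℝ_{>0} Tˣ` onto `H_γ = ℝ_{>0} Dˣ ∩ C_{D_𝔸ˣ}(γ)` (`unitsTorusEquiv_mem_iff`, keyed on the adelic
  group data as in the trace formula).
* `units_quotientMeasure_centralizer_univ_eq_torus` — **the volume factor of a regular class
  equals the covolume of `ℝ_{>0} Tˣ` in `T_𝔸ˣ`**: for Haar-type measures corresponding under the
  isomorphism, `vol(G_γ ⧸ H_γ; ν_γ, ρ_F) = vol(T_𝔸ˣ ⧸ ℝ_{>0} Tˣ; ν_T, ρ_T)` (total masses of quotient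
  measures with Weil constant one; `quotientMeasure_univ_eq_of_mulEquiv` of
  `InvariantQuotientTransport`); `units_exists_torus_measures` — such `ν_T`, `ρ_T` exist for any
  given `ν_γ`, `ρ_F` (pull back along the isomorphism; `isMulRightInvariant_map_mulEquiv`).

Part of the inline (D-0026) decomposition of
`Literature.NumberTheory.Automorphic.strong_multiplicity_one_quaternionUnits` (Gelbart Thm. 10.5
(ii) with Thm. 10.10). Not treated here: the `GL₂` realisation of the tori and the matching of the
Haar measures on `ℝ_{>0}` of the two data (both are `posRealCentral`).

## References

* S. Gelbart, *Automorphic forms on adele groups*, Ann. of Math. Studies 83 (1975), Remark 9.23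
  (p. 140), (10.14) and p. 154–155 [Gelbart1975].
* M.-F. Vignéras, *Arithmétique des algèbres de quaternions*, LNM 800 (1980), Ch. III §1
  [VignerasLNM800].
-/

noncomputable section

open NumberField IsDedekindDomain MeasureTheory Measure Topology
open Literature.MeasureTheory.Group
open scoped NNReal ENNReal TensorProduct Pointwise

namespace Literature.NumberTheory.Automorphic

-- the coset spaces carry Borel σ-algebras supplied locally, not the quotient σ-algebra
attribute [-instance] Quotient.instMeasurableSpace QuotientGroup.measurableSpace

universe u

section TorusEquiv

variable (K : Type) [Field K] [NumberField K] (D : Type u) [Ring D] [Algebra K D]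

/-- `unitsMapRight f` is injective for injective `f` (`mapRight_injective`, flatness over the
field `K`, and `Units.map_injective`). [folklore] -/
theorem unitsMapRight_injective {D' : Type u} [Ring D'] [Algebra K D'] (f : D' →ₐ[K] D)
    (hf : Function.Injective f) : Function.Injective (unitsMapRight K D f) :=
  Units.map_injective (ScalarExtension.mapRight_injective K (AdeleRing (𝓞 K) K) f hf)

variable [Algebra.IsCentral K D]

/-- **The torus homomorphism `T_𝔸ˣ →* C_{D_𝔸ˣ}(γ)`**, `T = C_D(γ) = K(γ)` for a regular
`γ ∈ Dˣ` (`unitsMapRight K D T.val` with codomain restricted to the centraliser, which is its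
range, `centralizer_inclAdelic_eq_range`). [cite: Gelbart1975, Remark 9.23] -/
def quaternionTorusHom (hD : ∀ x : D, x ≠ 0 → IsUnit x) (h4 : Module.finrank K D = 4) (γ : Dˣ)
    (hγ : (γ : D) ∉ (⊥ : Subalgebra K D)) :
    adelicUnits K (Subalgebra.centralizer K ({(γ : D)} : Set D)) →*
      Subgroup.centralizer ({inclAdelic K D γ} : Set (adelicUnits K D)) :=
  (unitsMapRight K D (Subalgebra.centralizer K ({(γ : D)} : Set D)).val).codRestrict _ fun w => by
    rw [centralizer_inclAdelic_eq_range K D hD h4 γ hγ]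
    exact ⟨w, rfl⟩

/-- `quaternionTorusHom w = unitsMapRight T.val w` on underlying elements (definitional). [folklore] -/
@[simp]
theorem coe_quaternionTorusHom (hD : ∀ x : D, x ≠ 0 → IsUnit x) (h4 : Module.finrank K D = 4) (γ : Dˣ)
    (hγ : (γ : D) ∉ (⊥ : Subalgebra K D))
    (w : adelicUnits K (Subalgebra.centralizer K ({(γ : D)} : Set D))) :
    ((quaternionTorusHom K D hD h4 γ hγ w : Subgroup.centralizer ({inclAdelic K D γ} :
      Set (adelicUnits K D))) : adelicUnits K D) =
      unitsMapRight K D (Subalgebra.centralizer K ({(γ : D)} : Set D)).val w := rfl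

/-- `quaternionTorusHom` is bijective. [cite: Gelbart1975, Remark 9.23] -/
theorem quaternionTorusHom_bijective (hD : ∀ x : D, x ≠ 0 → IsUnit x) (h4 : Module.finrank K D = 4)
    (γ : Dˣ) (hγ : (γ : D) ∉ (⊥ : Subalgebra K D)) :
    Function.Bijective (quaternionTorusHom K D hD h4 γ hγ) := by
  refine ⟨fun a b hab => unitsMapRight_injective K D _ Subtype.val_injective
    (congrArg Subtype.val hab), ?_⟩
  rintro ⟨g, hg⟩
  rw [centralizer_inclAdelic_eq_range K D hD h4 γ hγ] at hg
  obtain ⟨w, rfl⟩ := hg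
  exact ⟨w, rfl⟩

/-- `quaternionTorusHom` is continuous. [folklore] -/
theorem continuous_quaternionTorusHom [Module.Finite K D] (hD : ∀ x : D, x ≠ 0 → IsUnit x)
    (h4 : Module.finrank K D = 4) (γ : Dˣ) (hγ : (γ : D) ∉ (⊥ : Subalgebra K D)) :
    Continuous (quaternionTorusHom K D hD h4 γ hγ) :=
  (continuous_unitsMapRight K D _).subtype_mk _

/-- `quaternionTorusHom` is an open map (open mapping theorem for the σ-compact `T_𝔸ˣ` onto the locally
compact `C_{D_𝔸ˣ}(γ)`, Mathlib `MonoidHom.isOpenMap_of_sigmaCompact`). [folklore] -/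
theorem isOpenMap_quaternionTorusHom [Module.Finite K D] (hD : ∀ x : D, x ≠ 0 → IsUnit x)
    (h4 : Module.finrank K D = 4) (γ : Dˣ) (hγ : (γ : D) ∉ (⊥ : Subalgebra K D)) :
    IsOpenMap (quaternionTorusHom K D hD h4 γ hγ) := by
  haveI : Nontrivial D := Module.nontrivial_of_finrank_pos (R := K) (by omega)
  obtain ⟨i₁, i₂, i₃⟩ := units_adelic_topology K D
  haveI : LocallyCompactSpace (adelicUnits K D) := i₁
  haveI : T2Space (adelicUnits K D) := i₂
  haveI : SecondCountableTopology (adelicUnits K D) := i₃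
  obtain ⟨j₁, j₂, j₃⟩ := units_adelic_topology K (Subalgebra.centralizer K ({(γ : D)} : Set D))
  haveI : LocallyCompactSpace (adelicUnits K (Subalgebra.centralizer K ({(γ : D)} : Set D))) := j₁
  haveI : T2Space (adelicUnits K (Subalgebra.centralizer K ({(γ : D)} : Set D))) := j₂
  haveI : SecondCountableTopology (adelicUnits K (Subalgebra.centralizer K ({(γ : D)} : Set D))) :=
    j₃
  haveI : IsClosed ((Subgroup.centralizer ({inclAdelic K D γ} : Set (adelicUnits K D)) :
      Subgroup (adelicUnits K D)) : Set (adelicUnits K D)) := isClosed_centralizer_singleton _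
  haveI : LocallyCompactSpace (Subgroup.centralizer ({inclAdelic K D γ} : Set (adelicUnits K D))) :=
    ‹IsClosed _›.isClosedEmbedding_subtypeVal.locallyCompactSpace
  exact MonoidHom.isOpenMap_of_sigmaCompact _ (quaternionTorusHom_bijective K D hD h4 γ hγ).2
    (continuous_quaternionTorusHom K D hD h4 γ hγ)

/-- **The adelic torus as a topological group: `T_𝔸ˣ ≃ₜ* C_{D_𝔸ˣ}(γ)`** for a regular
`γ ∈ Dˣ`, `T = K(γ)` (Gelbart (1975), Remark 9.23: `G_γ = K(γ)_𝔸ˣ`): `quaternionTorusHom` is a continuous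
open bijective homomorphism. [cite: Gelbart1975, Remark 9.23] -/
def quaternionTorusEquiv [Module.Finite K D] (hD : ∀ x : D, x ≠ 0 → IsUnit x)
    (h4 : Module.finrank K D = 4) (γ : Dˣ) (hγ : (γ : D) ∉ (⊥ : Subalgebra K D)) :
    adelicUnits K (Subalgebra.centralizer K ({(γ : D)} : Set D)) ≃ₜ*
      Subgroup.centralizer ({inclAdelic K D γ} : Set (adelicUnits K D)) :=
  { MulEquiv.ofBijective (quaternionTorusHom K D hD h4 γ hγ) (quaternionTorusHom_bijective K D hD h4 γ hγ) with
    continuous_toFun := continuous_quaternionTorusHom K D hD h4 γ hγ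
    continuous_invFun :=
      ((Equiv.ofBijective _ (quaternionTorusHom_bijective K D hD h4 γ hγ)).toHomeomorphOfContinuousOpen
        (continuous_quaternionTorusHom K D hD h4 γ hγ) (isOpenMap_quaternionTorusHom K D hD h4 γ hγ)).continuous_symm }

/-- `quaternionTorusEquiv w = unitsMapRight T.val w` on underlying elements (definitional). [folklore] -/
@[simp]
theorem coe_quaternionTorusEquiv [Module.Finite K D] (hD : ∀ x : D, x ≠ 0 → IsUnit x)
    (h4 : Module.finrank K D = 4) (γ : Dˣ) (hγ : (γ : D) ∉ (⊥ : Subalgebra K D))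
    (w : adelicUnits K (Subalgebra.centralizer K ({(γ : D)} : Set D))) :
    ((quaternionTorusEquiv K D hD h4 γ hγ w : Subgroup.centralizer ({inclAdelic K D γ} :
      Set (adelicUnits K D))) : adelicUnits K D) =
      unitsMapRight K D (Subalgebra.centralizer K ({(γ : D)} : Set D)).val w := rfl

/-- **Rational units of the torus inside `ℝ_{>0} Dˣ` come from `ℝ_{>0} Tˣ`**: for a regular
`γ ∈ Dˣ` with `T = K(γ)` and `w ∈ T_𝔸ˣ`, `w ∈ ℝ_{>0} · Tˣ` iff its image in `D_𝔸ˣ` lies in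
`ℝ_{>0} · Dˣ` (if the image is `a · d` with `a ∈ ℝ_{>0}` central and `d ∈ Dˣ`, then `d` commutes
with `γ`, so `d ∈ Tˣ`, and `w = a · d` by injectivity). Hence `quaternionTorusEquiv` carries
`ℝ_{>0} Tˣ` onto `ℝ_{>0} Dˣ ∩ C_{D_𝔸ˣ}(γ)`. [cite: Gelbart1975, Remark 9.23] -/
theorem unitsMapRight_mem_quotientSubgroup_iff [Module.Finite K D] (hD : ∀ x : D, x ≠ 0 → IsUnit x)
    (h4 : Module.finrank K D = 4) (γ : Dˣ) (hγ : (γ : D) ∉ (⊥ : Subalgebra K D))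
    (w : adelicUnits K (Subalgebra.centralizer K ({(γ : D)} : Set D))) :
    unitsMapRight K D (Subalgebra.centralizer K ({(γ : D)} : Set D)).val w ∈
        (AdelicGroupData.units K D).quotientSubgroup ↔
      w ∈ (AdelicGroupData.units K (Subalgebra.centralizer K ({(γ : D)} : Set D))).quotientSubgroup := by
  haveI : Nontrivial D := Module.nontrivial_of_finrank_pos (R := K) (by omega)
  refine ⟨fun hw => ?_, fun hw => map_quotientSubgroup_units_le K D (Subalgebra.centralizer K ({(γ : D)} : Set D)).val ⟨w, hw, rfl⟩⟩
  -- write the image as `a * x`, `a ∈ ℝ_{>0}` central, `x ∈ Dˣ` (central retraction)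
  haveI : LocallyCompactSpace (AdeleRing (𝓞 K) K) := locallyCompactSpace_adeleRing' K
  obtain ⟨θ, -, hθA, hθa, hθγ⟩ := exists_centralRetraction_units K D
  have hx := (AdelicGroupData.mem_quotientSubgroup_iff_of_centralRetraction
    (AdelicGroupData.units K D) θ hθA hθa hθγ _).1 hw
  obtain ⟨(d : Dˣ), hd⟩ := hx
  have hd' : inclAdelic K D d = (θ (unitsMapRight K D (Subalgebra.centralizer K ({(γ : D)} : Set D)).val w))⁻¹ * unitsMapRight K D (Subalgebra.centralizer K ({(γ : D)} : Set D)).val w := hd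
  obtain ⟨t, ht⟩ := hθA (unitsMapRight K D (Subalgebra.centralizer K ({(γ : D)} : Set D)).val w)
  have hax : posRealCentral K D t * inclAdelic K D d = unitsMapRight K D (Subalgebra.centralizer K ({(γ : D)} : Set D)).val w := by
    rw [hd', ht, mul_inv_cancel_left]
  -- `d` commutes with `γ`
  have hcomm : inclAdelic K D d * inclAdelic K D γ = inclAdelic K D γ * inclAdelic K D d := by
    have h1 : unitsMapRight K D (Subalgebra.centralizer K ({(γ : D)} : Set D)).val w ∈
        Subgroup.centralizer ({inclAdelic K D γ} : Set (adelicUnits K D)) := by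
      rw [centralizer_inclAdelic_eq_range K D hD h4 γ hγ]; exact ⟨w, rfl⟩
    have h2 : posRealCentral K D t ∈ Subgroup.center (adelicUnits K D) :=
      posRealCentral_mem_center K D t
    have h3 := Subgroup.mem_centralizer_iff.1 h1 (inclAdelic K D γ) (Set.mem_singleton _)
    rw [← hax] at h3
    have ha : inclAdelic K D γ * posRealCentral K D t = posRealCentral K D t * inclAdelic K D γ :=
      Subgroup.mem_center_iff.1 h2 (inclAdelic K D γ)
    have h5 : posRealCentral K D t * (inclAdelic K D γ * inclAdelic K D d) =
        posRealCentral K D t * (inclAdelic K D d * inclAdelic K D γ) := by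
      calc posRealCentral K D t * (inclAdelic K D γ * inclAdelic K D d)
          = inclAdelic K D γ * posRealCentral K D t * inclAdelic K D d := by rw [ha, mul_assoc]
        _ = inclAdelic K D γ * (posRealCentral K D t * inclAdelic K D d) := by rw [mul_assoc]
        _ = posRealCentral K D t * inclAdelic K D d * inclAdelic K D γ := h3
        _ = posRealCentral K D t * (inclAdelic K D d * inclAdelic K D γ) := by rw [mul_assoc]
    exact (mul_left_cancel h5).symm
  have hcommD : (d : D) * γ = γ * d := by
    have h5 : inclAdelic K D (d * γ) = inclAdelic K D (γ * d) := by rw [map_mul, map_mul, hcomm]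
    have h6 : d * γ = γ * d := Units.map_injective (incl_injective_of_isUnit K D hD) h5
    exact congrArg Units.val h6
  -- so `d ∈ T`, a unit of the field `T`
  have hdT : (d : D) ∈ (Subalgebra.centralizer K ({(γ : D)} : Set D)) := (Subalgebra.mem_centralizer_iff K).2 fun g hg => by
    rw [Set.mem_singleton_iff] at hg; subst hg; exact hcommD.symm
  have hne : (⟨(d : D), hdT⟩ : (Subalgebra.centralizer K ({(γ : D)} : Set D))) ≠ 0 := fun h => by
    have h' : (d : D) = 0 := congrArg Subtype.val h
    exact d.ne_zero h'
  obtain ⟨d', hd''⟩ := forall_isUnit_centralizer K D hD (γ : D) ⟨(d : D), hdT⟩ hne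
  have hmap : Units.map (Subalgebra.centralizer K ({(γ : D)} : Set D)).val.toRingHom.toMonoidHom d' = d := Units.ext (by
    rw [Units.coe_map]
    change (Subalgebra.centralizer K ({(γ : D)} : Set D)).val (d' : (Subalgebra.centralizer K ({(γ : D)} : Set D))) = d
    rw [hd'']
    rfl)
  -- hence `w = a · d'` by injectivity
  have hinj := unitsMapRight_injective K D (Subalgebra.centralizer K ({(γ : D)} : Set D)).val Subtype.val_injective
  have hw2 : w = posRealCentral K (Subalgebra.centralizer K ({(γ : D)} : Set D)) t * inclAdelic K (Subalgebra.centralizer K ({(γ : D)} : Set D)) d' := hinj (by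
    rw [map_mul, unitsMapRight_posRealCentral, unitsMapRight_inclAdelic, hmap, hax])
  rw [hw2]
  change posRealCentral K (Subalgebra.centralizer K ({(γ : D)} : Set D)) t * inclAdelic K (Subalgebra.centralizer K ({(γ : D)} : Set D)) d' ∈
    (posRealCentral K (Subalgebra.centralizer K ({(γ : D)} : Set D))).range ⊔ (inclAdelic K (Subalgebra.centralizer K ({(γ : D)} : Set D))).range
  exact Subgroup.mul_mem_sup ⟨t, rfl⟩ ⟨d', rfl⟩

end TorusEquiv

/-! ### The volume factor of a regular class is the covolume of `ℝ_{>0} K(γ)ˣ` in `K(γ)_𝔸ˣ` -/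

section Volume

variable (K : Type) [Field K] [NumberField K] (D : Type u) [Ring D] [Algebra K D]
  [IsQuaternionAlgebra K D]

attribute [local instance] AdelicGroupData.measurableSpaceQuotientForm
  AdelicGroupData.borelSpaceQuotientForm

local notation "GD" => AdelicGroupData.units K D

/-- **The torus isomorphism, keyed on the adelic group datum**: for a regular `γ ∈ Dˣ` with
`T = K(γ) = C_D(γ)`, `T_𝔸ˣ ≃ₜ* C_{D_𝔸ˣ}(γ)` (`quaternionTorusEquiv`, with `D_𝔸ˣ`, `γ` spelled through
`AdelicGroupData.units K D`, as in the trace formula). [cite: Gelbart1975, Remark 9.23] -/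
def unitsTorusEquiv (hD : ∀ x : D, x ≠ 0 → IsUnit x) (γ : Dˣ) (hγ : (γ : D) ∉ (⊥ : Subalgebra K D)) :
    (AdelicGroupData.units K (Subalgebra.centralizer K ({(γ : D)} : Set D))).Adelic ≃ₜ*
      Subgroup.centralizer ({(GD).toAdelic γ} : Set (GD).Adelic) :=
  quaternionTorusEquiv K D hD (IsQuaternionAlgebra.finrank_eq_four (K := K) (D := D)) γ hγ

/-- `unitsTorusEquiv w = unitsMapRight T.val w` on underlying elements (definitional). [folklore] -/
@[simp]
theorem coe_unitsTorusEquiv (hD : ∀ x : D, x ≠ 0 → IsUnit x) (γ : Dˣ)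
    (hγ : (γ : D) ∉ (⊥ : Subalgebra K D))
    (w : (AdelicGroupData.units K (Subalgebra.centralizer K ({(γ : D)} : Set D))).Adelic) :
    ((unitsTorusEquiv K D hD γ hγ w : Subgroup.centralizer ({(GD).toAdelic γ} : Set (GD).Adelic)) :
      (GD).Adelic) = unitsMapRight K D (Subalgebra.centralizer K ({(γ : D)} : Set D)).val w := rfl

/-- **`unitsTorusEquiv` carries `ℝ_{>0} Tˣ` onto `ℝ_{>0} Dˣ ∩ C_{D_𝔸ˣ}(γ)`**
(`unitsMapRight_mem_quotientSubgroup_iff`). [cite: Gelbart1975, Remark 9.23] -/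
theorem unitsTorusEquiv_mem_iff (hD : ∀ x : D, x ≠ 0 → IsUnit x) (γ : Dˣ)
    (hγ : (γ : D) ∉ (⊥ : Subalgebra K D))
    (w : (AdelicGroupData.units K (Subalgebra.centralizer K ({(γ : D)} : Set D))).Adelic) :
    unitsTorusEquiv K D hD γ hγ w ∈ ((GD).quotientSubgroup ⊓
        Subgroup.centralizer ({(GD).toAdelic γ} : Set (GD).Adelic)).subgroupOf
          (Subgroup.centralizer ({(GD).toAdelic γ} : Set (GD).Adelic)) ↔
      w ∈ (AdelicGroupData.units K (Subalgebra.centralizer K ({(γ : D)} : Set D))).quotientSubgroup := by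
  rw [Subgroup.mem_subgroupOf, Subgroup.mem_inf]
  constructor
  · intro h
    exact (unitsMapRight_mem_quotientSubgroup_iff K D hD
      (IsQuaternionAlgebra.finrank_eq_four (K := K) (D := D)) γ hγ w).1 h.1
  · intro h
    exact ⟨(unitsMapRight_mem_quotientSubgroup_iff K D hD
      (IsQuaternionAlgebra.finrank_eq_four (K := K) (D := D)) γ hγ w).2 h,
      (unitsTorusEquiv K D hD γ hγ w).2⟩

/-- **The volume factor of a regular class of the `D^×` trace formula is the covolume of
`ℝ_{>0} K(γ)ˣ` in the idele group `K(γ)_𝔸ˣ`** (Gelbart (1975), (10.14) and p. 154: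
`meas(Z'_𝔸 B_F \ B_𝔸)`, `B` the centraliser of the quadratic extension `E = K(γ)`; Remark 9.23:
`meas(Z_∞⁺ G(γ)_ℚ \ G(γ)_𝔸)`). Let `D` be a division quaternion algebra over `K`, `γ ∈ Dˣ`
regular (`γ ∉ K`), `T = K(γ)`, `G_γ = C_{D_𝔸ˣ}(γ)`, `H_γ = ℝ_{>0} Dˣ ∩ G_γ`, and
`e = unitsTorusEquiv : T_𝔸ˣ ≃ₜ* G_γ` (carrying `ℝ_{>0} Tˣ` onto `H_γ`). If the Haar-type measures
correspond under `e` — `ν_γ = e_* ν_T` on `G_γ` and `ρ_F = (e|)_* ρ_T` on `H_γ` — then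

  `vol(G_γ ⧸ H_γ; ν_γ, ρ_F) = vol(T_𝔸ˣ ⧸ ℝ_{>0} Tˣ; ν_T, ρ_T)`,

both volumes being total masses of quotient measures with Weil constant one
(`quotientMeasure_univ_eq_of_mulEquiv`, `InvariantQuotientTransport`). The right-hand side is
intrinsic to the quadratic field `T` and its measures; it is the quantity that reappears,
through the realisation of `T_𝔸ˣ` inside `GL₂(𝔸_K)`, in the elliptic terms of (10.15). The
instance binders hold by `units_adelic_topology`, `isClosed_quotientSubgroup_units` (for `D` and
for `T`) and `isClosed_centralizer_singleton`. [cite: Gelbart1975, (10.14) and Remark 9.23] -/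
theorem units_quotientMeasure_centralizer_univ_eq_torus (hD : ∀ x : D, x ≠ 0 → IsUnit x)
    (γ : Dˣ) (hγ : (γ : D) ∉ (⊥ : Subalgebra K D))
    [MeasurableSpace (GD).Adelic] [BorelSpace (GD).Adelic]
    [MeasurableSpace (AdelicGroupData.units K (Subalgebra.centralizer K ({(γ : D)} : Set D))).Adelic]
    [BorelSpace (AdelicGroupData.units K (Subalgebra.centralizer K ({(γ : D)} : Set D))).Adelic]
    [LocallyCompactSpace (GD).Adelic] [SecondCountableTopology (GD).Adelic] [T2Space (GD).Adelic]
    [LocallyCompactSpace (AdelicGroupData.units K (Subalgebra.centralizer K ({(γ : D)} : Set D))).Adelic]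
    [SecondCountableTopology
      (AdelicGroupData.units K (Subalgebra.centralizer K ({(γ : D)} : Set D))).Adelic]
    [T2Space (AdelicGroupData.units K (Subalgebra.centralizer K ({(γ : D)} : Set D))).Adelic]
    [hH : IsClosed ((GD).quotientSubgroup : Set (GD).Adelic)]
    [hHT : IsClosed (((AdelicGroupData.units K (Subalgebra.centralizer K ({(γ : D)} :
      Set D))).quotientSubgroup) :
        Set (AdelicGroupData.units K (Subalgebra.centralizer K ({(γ : D)} : Set D))).Adelic)]
    [hCcl : IsClosed ((Subgroup.centralizer ({(GD).toAdelic γ} : Set (GD).Adelic) :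
      Subgroup (GD).Adelic) : Set (GD).Adelic)]
    [MeasurableSpace (↥(Subgroup.centralizer ({(GD).toAdelic γ} : Set (GD).Adelic)) ⧸
      ((GD).quotientSubgroup ⊓ Subgroup.centralizer ({(GD).toAdelic γ} : Set (GD).Adelic)).subgroupOf
        (Subgroup.centralizer ({(GD).toAdelic γ} : Set (GD).Adelic)))]
    [BorelSpace (↥(Subgroup.centralizer ({(GD).toAdelic γ} : Set (GD).Adelic)) ⧸
      ((GD).quotientSubgroup ⊓ Subgroup.centralizer ({(GD).toAdelic γ} : Set (GD).Adelic)).subgroupOf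
        (Subgroup.centralizer ({(GD).toAdelic γ} : Set (GD).Adelic)))]
    (νC : Measure (Subgroup.centralizer ({(GD).toAdelic γ} : Set (GD).Adelic)))
    [IsHaarMeasure νC] [νC.IsMulRightInvariant]
    (ρF : Measure ↥(((GD).quotientSubgroup ⊓ Subgroup.centralizer ({(GD).toAdelic γ} :
      Set (GD).Adelic)).subgroupOf (Subgroup.centralizer ({(GD).toAdelic γ} : Set (GD).Adelic))))
    [ρF.IsMulLeftInvariant] [IsFiniteMeasureOnCompacts ρF] [ρF.IsOpenPosMeasure] [ρF.IsInvInvariant]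
    [SFinite ρF]
    (νT : Measure (AdelicGroupData.units K (Subalgebra.centralizer K ({(γ : D)} : Set D))).Adelic)
    [IsHaarMeasure νT] [νT.IsMulRightInvariant]
    (ρT : Measure ↥((AdelicGroupData.units K (Subalgebra.centralizer K ({(γ : D)} :
      Set D))).quotientSubgroup))
    [ρT.IsMulLeftInvariant] [IsFiniteMeasureOnCompacts ρT] [ρT.IsOpenPosMeasure] [ρT.IsInvInvariant]
    [SFinite ρT]
    (hν : νC = Measure.map (unitsTorusEquiv K D hD γ hγ) νT)
    (hρ : ρF = Measure.map (subgroupCongrHomeomorph (unitsTorusEquiv K D hD γ hγ).toMulEquiv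
      ((AdelicGroupData.units K (Subalgebra.centralizer K ({(γ : D)} : Set D))).quotientSubgroup)
      (((GD).quotientSubgroup ⊓ Subgroup.centralizer ({(GD).toAdelic γ} :
        Set (GD).Adelic)).subgroupOf (Subgroup.centralizer ({(GD).toAdelic γ} : Set (GD).Adelic)))
      (unitsTorusEquiv_mem_iff K D hD γ hγ) (unitsTorusEquiv K D hD γ hγ).continuous
      (unitsTorusEquiv K D hD γ hγ).symm.continuous) ρT) :
    quotientMeasure (((GD).quotientSubgroup ⊓ Subgroup.centralizer ({(GD).toAdelic γ} :
        Set (GD).Adelic)).subgroupOf (Subgroup.centralizer ({(GD).toAdelic γ} : Set (GD).Adelic)))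
        ρF (isClosed_subgroupOf _ _ (hH.inter hCcl)) νC Set.univ =
      quotientMeasure ((AdelicGroupData.units K (Subalgebra.centralizer K ({(γ : D)} :
        Set D))).quotientSubgroup) ρT hHT νT Set.univ := by
  haveI : IsClosed (((((GD).quotientSubgroup ⊓ Subgroup.centralizer ({(GD).toAdelic γ} :
      Set (GD).Adelic)).subgroupOf (Subgroup.centralizer ({(GD).toAdelic γ} : Set (GD).Adelic))) :
        Subgroup (Subgroup.centralizer ({(GD).toAdelic γ} : Set (GD).Adelic))) :
          Set (Subgroup.centralizer ({(GD).toAdelic γ} : Set (GD).Adelic))) :=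
    isClosed_subgroupOf _ _ (hH.inter hCcl)
  exact quotientMeasure_univ_eq_of_mulEquiv (unitsTorusEquiv K D hD γ hγ).toMulEquiv
    (unitsTorusEquiv K D hD γ hγ).continuous (unitsTorusEquiv K D hD γ hγ).symm.continuous _ _
    (unitsTorusEquiv_mem_iff K D hD γ hγ) ρT ρF νT νC hρ hν

/-- The image of a right-invariant measure under a measurable group isomorphism is right
invariant. [folklore] -/
theorem isMulRightInvariant_map_mulEquiv {A B : Type*} [Group A] [Group B] [MeasurableSpace A]
    [MeasurableSpace B] [MeasurableMul A] [MeasurableMul B] (e : A ≃* B) (he : Measurable e)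
    (hes : Measurable e.symm) (μ : Measure A) [μ.IsMulRightInvariant] :
    (Measure.map e μ).IsMulRightInvariant := by
  refine isMulRightInvariant_of_map_mulEquiv e.symm hes he (Measure.map e μ) ?_
  rw [Measure.map_map hes he, show ((e.symm : B → A) ∘ (e : A → B)) = id from
    funext fun a => e.symm_apply_apply a, Measure.map_id]
  infer_instance

/-- **The torus measures exist** (non-vacuity of `units_quotientMeasure_centralizer_univ_eq_torus`):
given Haar-type measures `ν_γ` on `G_γ` and `ρ_F` on `H_γ`, their pull-backs `ν_T = e⁻¹_* ν_γ`,
`ρ_T = (e|)⁻¹_* ρ_F` along `e = unitsTorusEquiv` are Haar-type measures on `T_𝔸ˣ`, `ℝ_{>0} Tˣ`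
with `ν_γ = e_* ν_T`, `ρ_F = (e|)_* ρ_T`. [folklore] -/
theorem units_exists_torus_measures (hD : ∀ x : D, x ≠ 0 → IsUnit x)
    (γ : Dˣ) (hγ : (γ : D) ∉ (⊥ : Subalgebra K D))
    [MeasurableSpace (GD).Adelic] [BorelSpace (GD).Adelic]
    [MeasurableSpace (AdelicGroupData.units K (Subalgebra.centralizer K ({(γ : D)} : Set D))).Adelic]
    [BorelSpace (AdelicGroupData.units K (Subalgebra.centralizer K ({(γ : D)} : Set D))).Adelic]
    (νC : Measure (Subgroup.centralizer ({(GD).toAdelic γ} : Set (GD).Adelic)))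
    [IsHaarMeasure νC] [νC.IsMulRightInvariant]
    (ρF : Measure ↥(((GD).quotientSubgroup ⊓ Subgroup.centralizer ({(GD).toAdelic γ} :
      Set (GD).Adelic)).subgroupOf (Subgroup.centralizer ({(GD).toAdelic γ} : Set (GD).Adelic))))
    [IsHaarMeasure ρF] [ρF.IsInvInvariant] [SFinite ρF] :
    ∃ (νT : Measure (AdelicGroupData.units K (Subalgebra.centralizer K ({(γ : D)} : Set D))).Adelic)
      (ρT : Measure ↥((AdelicGroupData.units K (Subalgebra.centralizer K ({(γ : D)} :
        Set D))).quotientSubgroup)),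
      IsHaarMeasure νT ∧ νT.IsMulRightInvariant ∧ IsHaarMeasure ρT ∧ ρT.IsInvInvariant ∧
      SFinite ρT ∧ νC = Measure.map (unitsTorusEquiv K D hD γ hγ) νT ∧
      ρF = Measure.map (subgroupCongrHomeomorph (unitsTorusEquiv K D hD γ hγ).toMulEquiv
        ((AdelicGroupData.units K (Subalgebra.centralizer K ({(γ : D)} : Set D))).quotientSubgroup)
        (((GD).quotientSubgroup ⊓ Subgroup.centralizer ({(GD).toAdelic γ} :
          Set (GD).Adelic)).subgroupOf (Subgroup.centralizer ({(GD).toAdelic γ} : Set (GD).Adelic)))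
        (unitsTorusEquiv_mem_iff K D hD γ hγ) (unitsTorusEquiv K D hD γ hγ).continuous
        (unitsTorusEquiv K D hD γ hγ).symm.continuous) ρT := by
  set e := unitsTorusEquiv K D hD γ hγ with he
  set eH := subgroupCongrHomeomorph e.toMulEquiv
    ((AdelicGroupData.units K (Subalgebra.centralizer K ({(γ : D)} : Set D))).quotientSubgroup)
    (((GD).quotientSubgroup ⊓ Subgroup.centralizer ({(GD).toAdelic γ} :
      Set (GD).Adelic)).subgroupOf (Subgroup.centralizer ({(GD).toAdelic γ} : Set (GD).Adelic)))
    (unitsTorusEquiv_mem_iff K D hD γ hγ) e.continuous e.symm.continuous with heH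
  -- the multiplicative structure of `eH`
  set eHm : ↥((AdelicGroupData.units K (Subalgebra.centralizer K ({(γ : D)} :
      Set D))).quotientSubgroup) ≃*
      ↥(((GD).quotientSubgroup ⊓ Subgroup.centralizer ({(GD).toAdelic γ} :
        Set (GD).Adelic)).subgroupOf (Subgroup.centralizer ({(GD).toAdelic γ} : Set (GD).Adelic))) :=
    { eH.toEquiv with
      map_mul' := fun x y => Subtype.ext (map_mul e.toMulEquiv (x : (AdelicGroupData.units K
        (Subalgebra.centralizer K ({(γ : D)} : Set D))).Adelic) y) } with heHm
  have heHm_coe : ∀ x, eHm x = eH x := fun x => rfl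
  have heHm_symm_coe : ∀ y, eHm.symm y = eH.symm y := fun y => rfl
  refine ⟨Measure.map e.symm νC, Measure.map eHm.symm ρF, inferInstance,
    isMulRightInvariant_map_mulEquiv e.symm.toMulEquiv e.symm.continuous.measurable
      e.continuous.measurable νC,
    MulEquiv.isHaarMeasure_map ρF eHm.symm eH.symm.continuous eH.continuous,
    isInvInvariant_map_mulEquiv eHm.symm eH.symm.continuous.measurable ρF, inferInstance, ?_, ?_⟩
  · exact (e.toHomeomorph.toMeasurableEquiv.map_map_symm (ν := νC)).symm
  · exact (eH.toMeasurableEquiv.map_map_symm (ν := ρF)).symm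

end Volume

/-! ### The inverse torus isomorphisms on underlying adelic units -/

section Inverse

variable (K : Type) [Field K] [NumberField K] (D : Type u) [Ring D] [Algebra K D]

/-- **`(1 ⊗ val) (Ψ'⁻¹ c) = c`**: the inverse of `quaternionTorusEquiv` followed by the torus map
`unitsMapRight T.val : T_𝔸ˣ → D_𝔸ˣ` is the inclusion of the centraliser. [folklore] -/
@[simp]
theorem unitsMapRight_quaternionTorusEquiv_symm_apply [Module.Finite K D] [Algebra.IsCentral K D]
    (hD : ∀ x : D, x ≠ 0 → IsUnit x) (h4 : Module.finrank K D = 4) (γ : Dˣ) (hγ : (γ : D) ∉ (⊥ : Subalgebra K D))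
    (c : Subgroup.centralizer ({inclAdelic K D γ} : Set (adelicUnits K D))) :
    unitsMapRight K D (Subalgebra.centralizer K ({(γ : D)} : Set D)).val ((quaternionTorusEquiv K D hD h4 γ hγ).symm c) =
      (c : adelicUnits K D) :=
  congrArg Subtype.val ((quaternionTorusEquiv K D hD h4 γ hγ).apply_symm_apply c)

/-- The same for the torus keyed on the adelic group datum: `(1 ⊗ val) (unitsTorusEquiv⁻¹ c) = c`.
[folklore] -/
@[simp]
theorem unitsMapRight_unitsTorusEquiv_symm_apply [IsQuaternionAlgebra K D]
    (hD : ∀ x : D, x ≠ 0 → IsUnit x) (γ : Dˣ) (hγ : (γ : D) ∉ (⊥ : Subalgebra K D))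
    (c : Subgroup.centralizer ({(AdelicGroupData.units K D).toAdelic γ} : Set (AdelicGroupData.units K D).Adelic)) :
    unitsMapRight K D (Subalgebra.centralizer K ({(γ : D)} : Set D)).val ((unitsTorusEquiv K D hD γ hγ).symm c) =
      ((c : (AdelicGroupData.units K D).Adelic) : adelicUnits K D) :=
  congrArg Subtype.val ((unitsTorusEquiv K D hD γ hγ).apply_symm_apply c)

end Inverse

end Literature.NumberTheory.Automorphic
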